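import Summits.CriticalPhenomena.PercolationContinuityZ3.Theorems.FK.MagnetizationPlateauLowerBound
import HarnessLib

/-!
# LARGE DEVIATIONS OF THE MAGNETISATION UNDER THE INFINITE-VOLUME (DLR) GIBBS STATES: THE PLATEAU AT SUB-VOLUME-ORDER COST,
# EXPONENTIAL TAILS BEYOND `±m*`, EXPONENTIAL CONCENTRATION IN THE UNIQUENESS REGION (Ellis 2006 Thm. V.6.1 and Note 13 to Ch. IV;
# Föllmer–Orey 1988; Olla 1988)

Claimed R42 (8)(c) in the cell INBOX at 2026-08-29T11:54:27Z by fkp-10a gen 360 (NEW CLAIM #1 of the gen), addressed to the lane under (ι) (coordinator fk-4 gen 295 CLOSED l.8907 11:26:11Z 2026-08-29; «(ι) RESUMES») and to the next seated fk-4 generation (ruling R182 requested); lineage row FO-10a-g360 (self-suggested), package g360-plateau, label PL-E.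
Helper file of the `fk-continuity` build cell (bschramm lane; `--supports stmt-CriticalPhenomena-4575`; fkp-10a gen 360,
package g360-plateau, label PL-E); builds on p205010 (kernel theorem, internal audit signed; external expert review
pending). No definitions, no named facts, no sorries; standard axioms.
UNCONDITIONAL (nearest-neighbour Ising model on `ℤ^d`, `d ≥ 1`, `β > 0`; `μ` any DLR Gibbs measure of the Ising specification
at `(β, h)` (`μ ∈ isingGibbsMeasures d β h`); boxes `Λ_N = {−N,…,N}^d`, `M_N = Σ_{x∈Λ_N} σ_x`).
Scope: volume-order bounds for the window / half-line probabilities of `M_N/|Λ_N|` under infinite-volume Gibbs states, by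
integrating UNIFORM-in-the-boundary-condition finite-volume bounds against the DLR equation; no almost-sure statement, no
ergodic decomposition, no surface-order rate; nothing percolation-bearing.

The DLR equation `μ(A) = ∫ μ^{η}_{Λ_N;β,h}(A) dμ(η)` turns every bound valid for ALL boundary conditions `η` at once into a bound
for every Gibbs state (`le_measureReal_of_forall_fixed`, `measureReal_le_of_forall_fixed`). With the uniform statements of
`MagnetizationUniformConcentration` (upper bounds) and `MagnetizationPlateauLowerBound` (the plateau), for every `μ ∈ 𝒢(β,h)`:

* `gibbs_measureReal_le_sum_spinAt_le` / `gibbs_measureReal_sum_spinAt_le_le` — the Chernoff large-deviation UPPER bounds for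
  half-lines, `μ{m|Λ_N| ≤ M_N} ≤ exp(−|Λ_N|(βsm − (ψ(β,h+s) − ψ(β,h)) − ε))` (`βs ≥ 0`) and the mirror image;
* `gibbs_upper_tail_exp_decay_of_spontaneousMagnetization_lt` / `gibbs_lower_tail_exp_decay_of_lt_neg_spontaneousMagnetization` —
  at `h = 0`: no density above `m*` or below `−m*` at volume order, `μ{M_N ≥ m|Λ_N|} ≤ e^{−c|Λ_N|}` (`m > m*`), for EVERY `μ ∈ 𝒢(β,0)`
  (pure phases, mixtures, non-translation-invariant states alike);
* **`gibbs_exp_le_plateau_window`** — at `h = 0`, for `|a| ≤ m*(β)`: eventually `e^{−ε|Λ_N|} ≤ μ{|M_N/|Λ_N| − a| < δ}` for EVERY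
  `μ ∈ 𝒢(β,0)`; hence `gibbs_not_eventually_plateau_window_le_exp`: under the `+` state (indeed under every Gibbs state) the
  windows below `m*` are NOT exponentially unlikely at volume order — the lower half of Ellis' Note 13 to Ch. IV («converges to 0
  but not exponentially fast»), for all densities of the plateau and all DLR states;
* **`gibbs_exp_concentration_of_hasUniqueGibbsMeasure`**, `gibbs_exp_concentration_of_field_ne_zero` — in the uniqueness region
  (`h ≠ 0`, or `h = 0 ∧ β ≤ β_c` for `d ≥ 2`) the unique Gibbs state satisfies the EXPONENTIAL law of large numbers
  `μ{ε ≤ |M_N/|Λ_N| − sign(h) m(β,|h|)|} ≤ e^{−c|Λ_N|}` (Ellis Thm. V.6.1 (c): `S_Λ/|Λ| → m(β,h)` exponentially).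

## References

* R. S. Ellis, *Entropy, Large Deviations, and Statistical Mechanics*, Springer (2006), Thm. II.6.1, Thm. IV.6.6, Thm. V.6.1 (c)–(e),
  Note 13 to Ch. IV (p. 117). [Ellis2006]
* H. Föllmer, S. Orey, Ann. Probab. 16 (1988) 961–977, §3. [FollmerOrey1988]
* S. Olla, PTRF 77 (1988), Thm. 5.2. [Olla1988]
* H.-O. Georgii, *Gibbs Measures and Phase Transitions*, de Gruyter (2011), Def. 1.23 (DLR equation). [Georgii2011]
* S. Friedli, Y. Velenik, *Statistical Mechanics of Lattice Systems*, CUP (2017), Def. 6.13, Thm. 3.34, Prop. 3.29. [FriedliVelenik2017]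
-/

noncomputable section

namespace Summit.CriticalPhenomena.PercolationContinuityZ3.Theorems.FK

namespace IsingLargeDeviations

open MeasureTheory Filter Topology Finset Set
open scoped ENNReal
open Literature.Probability.LatticeModels

variable {d : ℕ}

/-! ### DLR: bounds uniform in the boundary condition pass to every Gibbs state -/

/-- **DLR LOWER TRANSFER**: if `p ≤ μ^{η}_{Λ;β,h}(A)` for every boundary configuration `η`, then `p ≤ μ(A)` for every Gibbs measure
`μ ∈ 𝒢(β,h)` (`μ(A) = ∫ μ^{η}_Λ(A) dμ(η)`). [cite: Georgii2011, Def. 1.23; FriedliVelenik2017, Def. 6.13] -/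
theorem le_measure_of_forall_fixed {β h : ℝ} {μ : Measure (SpinConfig (Site d))} (hμ : μ ∈ isingGibbsMeasures d β h)
    (Λ : Finset (Site d)) {A : Set (SpinConfig (Site d))} (hA : MeasurableSet A) {p : ℝ≥0∞}
    (hp : ∀ η : SpinConfig (Site d), p ≤ isingMeasure (zdGraph d) Λ β h (.fixed η) A) : p ≤ μ A := by
  have hG : IsGibbsMeasure (isingSpecification (zdGraph d) β h) μ := hμ
  haveI := hG.isProbabilityMeasure
  rw [← hG.2 Λ A hA]
  calc p = ∫⁻ _η, p ∂μ := by rw [lintegral_const, measure_univ, mul_one]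
    _ ≤ ∫⁻ η, isingSpecification (zdGraph d) β h Λ η A ∂μ :=
        lintegral_mono fun η => by rw [isingSpecification_apply]; exact hp η

/-- **DLR UPPER TRANSFER**: if `μ^{η}_{Λ;β,h}(A) ≤ P` for every `η`, then `μ(A) ≤ P` for every `μ ∈ 𝒢(β,h)`.
[cite: Georgii2011, Def. 1.23; FriedliVelenik2017, Def. 6.13] -/
theorem measure_le_of_forall_fixed {β h : ℝ} {μ : Measure (SpinConfig (Site d))} (hμ : μ ∈ isingGibbsMeasures d β h)
    (Λ : Finset (Site d)) {A : Set (SpinConfig (Site d))} (hA : MeasurableSet A) {P : ℝ≥0∞}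
    (hP : ∀ η : SpinConfig (Site d), isingMeasure (zdGraph d) Λ β h (.fixed η) A ≤ P) : μ A ≤ P := by
  have hG : IsGibbsMeasure (isingSpecification (zdGraph d) β h) μ := hμ
  haveI := hG.isProbabilityMeasure
  rw [← hG.2 Λ A hA]
  calc ∫⁻ η, isingSpecification (zdGraph d) β h Λ η A ∂μ ≤ ∫⁻ _η, P ∂μ :=
        lintegral_mono fun η => by rw [isingSpecification_apply]; exact hP η
    _ = P := by rw [lintegral_const, measure_univ, mul_one]

/-- DLR lower transfer, real form: `p ≤ μ^{η}_Λ.real(A)` for all `η` (`0 ≤ p`) gives `p ≤ μ.real(A)`.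
[cite: Georgii2011, Def. 1.23] -/
theorem le_measureReal_of_forall_fixed {β h : ℝ} {μ : Measure (SpinConfig (Site d))} (hμ : μ ∈ isingGibbsMeasures d β h)
    (Λ : Finset (Site d)) {A : Set (SpinConfig (Site d))} (hA : MeasurableSet A) {p : ℝ} (hp0 : 0 ≤ p)
    (hp : ∀ η : SpinConfig (Site d), p ≤ (isingMeasure (zdGraph d) Λ β h (.fixed η)).real A) : p ≤ μ.real A := by
  have hG : IsGibbsMeasure (isingSpecification (zdGraph d) β h) μ := hμ
  haveI := hG.isProbabilityMeasure
  have hp' : ∀ η : SpinConfig (Site d), ENNReal.ofReal p ≤ isingMeasure (zdGraph d) Λ β h (.fixed η) A := fun η => by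
    rw [← ENNReal.ofReal_toReal (measure_ne_top _ A)]
    exact ENNReal.ofReal_le_ofReal (hp η)
  have h1 := le_measure_of_forall_fixed hμ Λ hA hp'
  rw [measureReal_def, ← ENNReal.toReal_ofReal hp0]
  exact ENNReal.toReal_mono (measure_ne_top _ _) h1

/-- DLR upper transfer, real form: `μ^{η}_Λ.real(A) ≤ P` for all `η` gives `μ.real(A) ≤ P`. [cite: Georgii2011, Def. 1.23] -/
theorem measureReal_le_of_forall_fixed {β h : ℝ} {μ : Measure (SpinConfig (Site d))} (hμ : μ ∈ isingGibbsMeasures d β h)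
    (Λ : Finset (Site d)) {A : Set (SpinConfig (Site d))} (hA : MeasurableSet A) {P : ℝ}
    (hP : ∀ η : SpinConfig (Site d), (isingMeasure (zdGraph d) Λ β h (.fixed η)).real A ≤ P) : μ.real A ≤ P := by
  have hG : IsGibbsMeasure (isingSpecification (zdGraph d) β h) μ := hμ
  haveI := hG.isProbabilityMeasure
  have hP0 : 0 ≤ P := measureReal_nonneg.trans (hP 1)
  have hP' : ∀ η : SpinConfig (Site d), isingMeasure (zdGraph d) Λ β h (.fixed η) A ≤ ENNReal.ofReal P := fun η => by
    rw [← ENNReal.ofReal_toReal (measure_ne_top _ A)]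
    exact ENNReal.ofReal_le_ofReal (hP η)
  have h1 := measure_le_of_forall_fixed hμ Λ hA hP'
  rw [measureReal_def, ← ENNReal.toReal_ofReal hP0]
  exact ENNReal.toReal_mono ENNReal.ofReal_ne_top h1

/-! ### Chernoff large-deviation upper bounds for every Gibbs state -/

/-- **LD UPPER BOUND, UPPER HALF-LINE, EVERY GIBBS STATE**: for `βs ≥ 0`, every `m`, `ε > 0` and every `μ ∈ 𝒢(β,h)`, eventually
`μ{m|Λ_N| ≤ M_N} ≤ exp(−|Λ_N|(βsm − (ψ(β,h+s) − ψ(β,h)) − ε))`. [cite: Ellis2006, Thm. II.6.1 (b) and Thm. V.6.1; Olla1988, Thm. 5.2] -/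
theorem gibbs_measureReal_le_sum_spinAt_le {β s h : ℝ} (hβs : 0 ≤ β * s) {μ : Measure (SpinConfig (Site d))}
    (hμ : μ ∈ isingGibbsMeasures d β h) (m : ℝ) {ε : ℝ} (hε : 0 < ε) :
    ∀ᶠ N : ℕ in atTop, μ.real {σ | m * #(box d N) ≤ ∑ x ∈ box d N, spinAt x σ} ≤
      Real.exp (-(#(box d N) * (β * s * m - (pressure d β (h + s) - pressure d β h) - ε))) := by
  filter_upwards [eventually_forall_bc_measureReal_le_sum_spinAt_le (d := d) hβs h m hε] with N hN
  exact measureReal_le_of_forall_fixed hμ (box d N) (measurableSet_le measurable_const (measurable_sum_spinAt _))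
    fun η => hN (.fixed η)

/-- **LD UPPER BOUND, LOWER HALF-LINE, EVERY GIBBS STATE**: for `βs ≥ 0`, eventually
`μ{M_N ≤ m|Λ_N|} ≤ exp(−|Λ_N|(−βsm − (ψ(β,h−s) − ψ(β,h)) − ε))`. [cite: Ellis2006, Thm. II.6.1 (b) and Thm. V.6.1; Olla1988, Thm. 5.2] -/
theorem gibbs_measureReal_sum_spinAt_le_le {β s h : ℝ} (hβs : 0 ≤ β * s) {μ : Measure (SpinConfig (Site d))}
    (hμ : μ ∈ isingGibbsMeasures d β h) (m : ℝ) {ε : ℝ} (hε : 0 < ε) :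
    ∀ᶠ N : ℕ in atTop, μ.real {σ | ∑ x ∈ box d N, spinAt x σ ≤ m * #(box d N)} ≤
      Real.exp (-(#(box d N) * (-(β * s * m) - (pressure d β (h - s) - pressure d β h) - ε))) := by
  filter_upwards [eventually_forall_bc_measureReal_sum_spinAt_le_le (d := d) hβs h m hε] with N hN
  exact measureReal_le_of_forall_fixed hμ (box d N) (measurableSet_le (measurable_sum_spinAt _) measurable_const)
    fun η => hN (.fixed η)

/-- **`h = 0`: NO DENSITY ABOVE `m*` UNDER ANY GIBBS STATE** (`d ≥ 1`, `β > 0`, `m > m*(β)`): `∃ c > 0`, eventually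
`μ{m|Λ_N| ≤ M_N} ≤ e^{−c|Λ_N|}` for every `μ ∈ 𝒢(β,0)`. [cite: Ellis2006, Thm. II.6.1 (b), Thm. V.6.1 (d) and Note 13 to Ch. IV] -/
theorem gibbs_upper_tail_exp_decay_of_spontaneousMagnetization_lt (hd : 1 ≤ d) {β : ℝ} (hβ : 0 < β) {m : ℝ}
    (hm : spontaneousMagnetization d β < m) :
    ∃ c : ℝ, 0 < c ∧ ∀ {μ : Measure (SpinConfig (Site d))}, μ ∈ isingGibbsMeasures d β 0 →
      ∀ᶠ N : ℕ in atTop, μ.real {σ | m * #(box d N) ≤ ∑ x ∈ box d N, spinAt x σ} ≤ Real.exp (-(c * #(box d N))) := by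
  obtain ⟨c, hc, h⟩ := upper_tail_exp_decay_uniform_of_spontaneousMagnetization_lt hd hβ hm
  refine ⟨c, hc, fun {μ} hμ => ?_⟩
  filter_upwards [h] with N hN
  exact measureReal_le_of_forall_fixed hμ (box d N) (measurableSet_le measurable_const (measurable_sum_spinAt _))
    fun η => hN (.fixed η)

/-- **`h = 0`: NO DENSITY BELOW `−m*` UNDER ANY GIBBS STATE**: for `m < −m*(β)`, `∃ c > 0`, eventually
`μ{M_N ≤ m|Λ_N|} ≤ e^{−c|Λ_N|}` for every `μ ∈ 𝒢(β,0)`. [cite: Ellis2006, Thm. II.6.1 (b), Thm. V.6.1 (d); FriedliVelenik2017, §3.7.1] -/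
theorem gibbs_lower_tail_exp_decay_of_lt_neg_spontaneousMagnetization (hd : 1 ≤ d) {β : ℝ} (hβ : 0 < β) {m : ℝ}
    (hm : m < -spontaneousMagnetization d β) :
    ∃ c : ℝ, 0 < c ∧ ∀ {μ : Measure (SpinConfig (Site d))}, μ ∈ isingGibbsMeasures d β 0 →
      ∀ᶠ N : ℕ in atTop, μ.real {σ | ∑ x ∈ box d N, spinAt x σ ≤ m * #(box d N)} ≤ Real.exp (-(c * #(box d N))) := by
  obtain ⟨c, hc, h⟩ := lower_tail_exp_decay_uniform_of_hasDerivWithinAt (d := d) hβ.le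
    (IsingSusceptibility.hasDerivWithinAt_pressure_field_zero_left hd hβ.le) (m := m) (by nlinarith)
  refine ⟨c, hc, fun {μ} hμ => ?_⟩
  filter_upwards [h] with N hN
  exact measureReal_le_of_forall_fixed hμ (box d N) (measurableSet_le (measurable_sum_spinAt _) measurable_const)
    fun η => hN (.fixed η)

/-! ### The plateau under every Gibbs state -/

/-- **THE PLATEAU UNDER EVERY INFINITE-VOLUME GIBBS STATE** (`d ≥ 1`, `β > 0`, `h = 0`): for `|a| ≤ m*(β)`, `δ, ε > 0` and every
`μ ∈ 𝒢(β,0)`, eventually `e^{−ε|Λ_N|} ≤ μ{|M_N/|Λ_N| − a| < δ}` — under the pure phases `μ^±`, their mixtures and every other DLR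
state, every density between `−m*` and `m*` is reached at sub-volume-order cost.
[cite: Ellis2006, Thm. V.6.1 (d)–(e) and Note 13 to Ch. IV; FollmerOrey1988, §3] -/
theorem gibbs_exp_le_plateau_window (hd : 1 ≤ d) {β : ℝ} (hβ : 0 < β) {a : ℝ} (ha : |a| ≤ spontaneousMagnetization d β)
    {δ : ℝ} (hδ : 0 < δ) {ε : ℝ} (hε : 0 < ε) {μ : Measure (SpinConfig (Site d))} (hμ : μ ∈ isingGibbsMeasures d β 0) :
    ∀ᶠ N : ℕ in atTop, Real.exp (-(ε * #(box d N))) ≤ μ.real {σ | |(∑ x ∈ box d N, spinAt x σ) / #(box d N) - a| < δ} := by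
  filter_upwards [eventually_forall_fixed_exp_le_plateau_window hd hβ ha hδ hε] with N hN
  exact le_measureReal_of_forall_fixed hμ (box d N)
    (measurableSet_lt (((measurable_sum_spinAt _).div_const _).sub_const _).abs measurable_const) (Real.exp_pos _).le hN

/-- **NOT EXPONENTIALLY FAST** (Ellis' Note 13 to Ch. IV, lower half, for every DLR state and every plateau density): for
`|a| ≤ m*(β)`, `δ > 0`, `c > 0` and `μ ∈ 𝒢(β,0)` it is NOT the case that eventually `μ{|M_N/|Λ_N| − a| < δ} ≤ e^{−c|Λ_N|}`.
[cite: Ellis2006, Note 13 to Ch. IV and Thm. IV.6.6 (b)] -/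
theorem gibbs_not_eventually_plateau_window_le_exp (hd : 1 ≤ d) {β : ℝ} (hβ : 0 < β) {a : ℝ}
    (ha : |a| ≤ spontaneousMagnetization d β) {δ : ℝ} (hδ : 0 < δ) {c : ℝ} (hc : 0 < c)
    {μ : Measure (SpinConfig (Site d))} (hμ : μ ∈ isingGibbsMeasures d β 0) :
    ¬ ∀ᶠ N : ℕ in atTop, μ.real {σ | |(∑ x ∈ box d N, spinAt x σ) / #(box d N) - a| < δ} ≤ Real.exp (-(c * #(box d N))) := by
  intro h
  obtain ⟨N, hN1, hN2⟩ := ((gibbs_exp_le_plateau_window hd hβ ha hδ (half_pos hc) hμ).and h).exists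
  have hV : (1 : ℝ) ≤ #(box d N) := by exact_mod_cast (box_nonempty d N).card_pos
  have := hN1.trans hN2
  rw [Real.exp_le_exp] at this
  nlinarith

/-! ### The uniqueness region: exponential law of large numbers under the unique Gibbs state -/

/-- **EXPONENTIAL LLN UNDER THE UNIQUE GIBBS STATE** (`d ≥ 1`, `β > 0`, `|𝒢(β,h)| = 1`): for the (unique) `μ ∈ 𝒢(β,h)` and every
`ε > 0` there is `c > 0` with `μ{ε ≤ |M_N/|Λ_N| − sign(h) m(β,|h|)|} ≤ e^{−c|Λ_N|}` eventually (Ellis Thm. V.6.1 (c): `S_Λ/|Λ| → m(β,h)`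
exponentially fast). [cite: Ellis2006, Thm. V.6.1 (c); Olla1988, Thm. 5.2; FriedliVelenik2017, Thm. 3.34] -/
theorem gibbs_exp_concentration_of_hasUniqueGibbsMeasure (hd : 1 ≤ d) {β : ℝ} (hβ : 0 < β) {h : ℝ}
    (hU : HasUniqueGibbsMeasure (isingSpecification (zdGraph d) β h)) {μ : Measure (SpinConfig (Site d))}
    (hμ : μ ∈ isingGibbsMeasures d β h) {ε : ℝ} (hε : 0 < ε) :
    ∃ c : ℝ, 0 < c ∧ ∀ᶠ N : ℕ in atTop,
      μ.real {σ | ε ≤ |(∑ x ∈ box d N, spinAt x σ) / #(box d N) - (Real.sign h * magnetizationInField d β |h|)|} ≤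
        Real.exp (-(c * #(box d N))) := by
  obtain ⟨c, hc, hconc⟩ := exp_concentration_uniform_of_hasUniqueGibbsMeasure hd hβ hU hε
  refine ⟨c, hc, ?_⟩
  filter_upwards [hconc] with N hN
  exact measureReal_le_of_forall_fixed hμ (box d N)
    (measurableSet_le measurable_const (((measurable_sum_spinAt _).div_const _).sub_const _).abs) fun η => hN (.fixed η)

/-- **`h ≠ 0`: EXPONENTIAL LLN AT `sign(h) m(β,|h|)` UNDER THE UNIQUE GIBBS STATE** (`d ≥ 1`, `β > 0`; uniqueness at `h ≠ 0` is the
tree's `hasUniqueGibbsMeasure_of_field_ne_zero`). [cite: Ellis2006, Thm. V.6.1 (c); FriedliVelenik2017, Thm. 3.43] -/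
theorem gibbs_exp_concentration_of_field_ne_zero (hd : 1 ≤ d) {β h : ℝ} (hβ : 0 < β) (hh : h ≠ 0)
    {μ : Measure (SpinConfig (Site d))} (hμ : μ ∈ isingGibbsMeasures d β h) {ε : ℝ} (hε : 0 < ε) :
    ∃ c : ℝ, 0 < c ∧ ∀ᶠ N : ℕ in atTop,
      μ.real {σ | ε ≤ |(∑ x ∈ box d N, spinAt x σ) / #(box d N) - (Real.sign h * magnetizationInField d β |h|)|} ≤
        Real.exp (-(c * #(box d N))) :=
  gibbs_exp_concentration_of_hasUniqueGibbsMeasure hd hβ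
    (IsingSusceptibility.hasUniqueGibbsMeasure_of_field_ne_zero hd hβ hh) hμ hε

end IsingLargeDeviations

end Summit.CriticalPhenomena.PercolationContinuityZ3.Theorems.FK
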